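import Mathlib.Analysis.SpecialFunctions.Integrals.Basic
import Mathlib.MeasureTheory.Integral.IntervalIntegral.IntegrationByParts
import Mathlib.MeasureTheory.Integral.IntervalIntegral.Periodic
import Mathlib.Analysis.SpecialFunctions.Trigonometric.Basic
import HarnessLib

/-!
# The mean value `2/π` of `|cos|`: `∫_a^b |cos v| dv/v ≤ (2/π) log(b/a) + O(1)`

Topic `Literature/NumberTheory/LFunctions`. Everything in this file is PROVED (no named facts).
This is the calculus input of the proof of Lemma 2.3 of Granville–Soundararajan, *Decay of mean
values of multiplicative functions* (2003): "Splitting the integral over `y` into intervals of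
length `2π` (with maybe one shorter interval), and noting that `(1/2π) ∫_0^{2π} |cos θ| dθ = 2/π`, we
deduce that `∫_{a}^{b} |cos y|/y dy ≤ (2/π) log(b/a) + O(1)`" (there with `a = (|β|/2) log Y ≥ 1/2`).

* `integral_abs_cos_zero_pi` : `∫_0^π |cos| = 2`;
* `integral_abs_cos_nat_mul_pi` : `∫_0^{nπ} |cos| = 2n`;
* `abs_integral_abs_cos_sub_le` : `|∫_0^v |cos| - (2/π) v| ≤ 2` for `v ≥ 0`;
* `integral_abs_cos_div_le` : `∫_a^b |cos v|/v dv ≤ (2/π) log(b/a) + 4/a` for `0 < a ≤ b`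
  (integration by parts against the primitive of `|cos|`);
* `integral_abs_cos_mul_div_le` : the rescaled form `∫_Λ^ℓ |cos(κ u)|/u du ≤ (2/π) log(ℓ/Λ) + 8`
  for `κ > 0`, `0 < Λ ≤ ℓ`, `κ Λ ≥ 1/2`.

## References

* A. Granville, K. Soundararajan, *Decay of mean values of multiplicative functions*, Canad. J.
  Math. 55 (2003), 1191–1230, proof of Lemma 2.3 (arXiv math/9911246, p. 5).
  [GranvilleSoundararajan2003]
-/

noncomputable section

open Real MeasureTheory Set intervalIntegral

namespace Literature.NumberTheory.LFunctions.GranvilleSoundararajan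

/-! ### `∫_0^{nπ} |cos| = 2n` -/

/-- `|cos|` is continuous. [folklore] -/
theorem continuous_abs_cos : Continuous fun x : ℝ => |Real.cos x| :=
  continuous_abs.comp Real.continuous_cos

/-- `|cos|` is interval integrable on every interval. [folklore] -/
theorem intervalIntegrable_abs_cos (a b : ℝ) :
    IntervalIntegrable (fun x : ℝ => |Real.cos x|) volume a b :=
  continuous_abs_cos.intervalIntegrable a b

/-- `|cos|` has period `π`. [folklore] -/
theorem periodic_abs_cos : Function.Periodic (fun x : ℝ => |Real.cos x|) π := by
  intro x
  simp [Real.cos_add_pi]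

/-- `∫_0^π |cos x| dx = 2` (`= ∫_0^{π/2} cos - ∫_{π/2}^π cos = 1 + 1`). [folklore] -/
theorem integral_abs_cos_zero_pi : ∫ x in (0 : ℝ)..π, |Real.cos x| = 2 := by
  have hpi : 0 < π := Real.pi_pos
  rw [← integral_add_adjacent_intervals (b := π / 2) (intervalIntegrable_abs_cos _ _)
    (intervalIntegrable_abs_cos _ _)]
  have h1 : ∫ x in (0 : ℝ)..π / 2, |Real.cos x| = ∫ x in (0 : ℝ)..π / 2, Real.cos x := by
    refine integral_congr fun x hx => ?_
    rw [uIcc_of_le (by positivity)] at hx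
    exact abs_of_nonneg (Real.cos_nonneg_of_mem_Icc ⟨by linarith [hx.1], hx.2⟩)
  have h2 : ∫ x in (π / 2 : ℝ)..π, |Real.cos x| = ∫ x in (π / 2 : ℝ)..π, -Real.cos x := by
    refine integral_congr fun x hx => ?_
    rw [uIcc_of_le (by linarith)] at hx
    exact abs_of_nonpos (Real.cos_nonpos_of_pi_div_two_le_of_le hx.1 (by linarith [hx.2]))
  rw [h1, h2, intervalIntegral.integral_neg, integral_cos, integral_cos]
  simp
  norm_num

/-- `∫_0^{nπ} |cos x| dx = 2n`. [folklore] -/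
theorem integral_abs_cos_nat_mul_pi (n : ℕ) : ∫ x in (0 : ℝ)..(n * π), |Real.cos x| = 2 * n := by
  induction n with
  | zero => simp
  | succ n ih =>
    have hsplit := integral_add_adjacent_intervals (a := (0 : ℝ)) (b := n * π) (c := (n + 1 : ℕ) * π)
      (intervalIntegrable_abs_cos _ _) (intervalIntegrable_abs_cos _ _)
    rw [← hsplit, ih]
    have hper : ∫ x in (n * π : ℝ)..((n + 1 : ℕ) * π), |Real.cos x| = 2 := by
      rw [show ((n + 1 : ℕ) : ℝ) * π = n * π + π by push_cast; ring,
        periodic_abs_cos.intervalIntegral_add_eq (n * π) 0, zero_add, integral_abs_cos_zero_pi]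
    rw [hper]
    push_cast
    ring

/-- The primitive of `|cos|` stays within `2` of `(2/π) v`: `|∫_0^v |cos x| dx - (2/π) v| ≤ 2` for
`v ≥ 0` (with `n = ⌊v/π⌋`, both quantities lie in `[2n, 2n+2]`). [folklore] -/
theorem abs_integral_abs_cos_sub_le {v : ℝ} (hv : 0 ≤ v) :
    |(∫ x in (0 : ℝ)..v, |Real.cos x|) - 2 / π * v| ≤ 2 := by
  have hpi : 0 < π := Real.pi_pos
  set n : ℕ := ⌊v / π⌋₊ with hn
  have hn1 : (n : ℝ) * π ≤ v := by
    have := Nat.floor_le (div_nonneg hv hpi.le)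
    rw [← hn] at this
    calc (n : ℝ) * π ≤ v / π * π := by gcongr
      _ = v := div_mul_cancel₀ v hpi.ne'
  have hn2 : v ≤ ((n + 1 : ℕ) : ℝ) * π := by
    have := Nat.lt_floor_add_one (v / π)
    rw [← hn] at this
    push_cast
    calc v = v / π * π := (div_mul_cancel₀ v hpi.ne').symm
      _ ≤ ((n : ℝ) + 1) * π := by gcongr
  have hnonneg : ∀ c d : ℝ, 0 ≤ᵐ[volume.restrict (Ioc c d)] fun x : ℝ => |Real.cos x| :=
    fun c d => Filter.Eventually.of_forall fun x => abs_nonneg _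
  -- lower bound: `2n ≤ ∫_0^v`
  have hlow : (2 * n : ℝ) ≤ ∫ x in (0 : ℝ)..v, |Real.cos x| := by
    rw [← integral_abs_cos_nat_mul_pi n]
    exact integral_mono_interval le_rfl (by positivity) hn1 (hnonneg _ _) (intervalIntegrable_abs_cos _ _)
  -- upper bound: `∫_0^v ≤ 2(n+1)`
  have hup : (∫ x in (0 : ℝ)..v, |Real.cos x|) ≤ 2 * ((n + 1 : ℕ) : ℝ) := by
    rw [← integral_abs_cos_nat_mul_pi (n + 1)]
    exact integral_mono_interval le_rfl hv hn2 (hnonneg _ _) (intervalIntegrable_abs_cos _ _)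
  push_cast at hup
  -- `2n ≤ (2/π) v ≤ 2n + 2`
  have hv1 : (2 * n : ℝ) ≤ 2 / π * v := by
    rw [div_mul_eq_mul_div, le_div_iff₀ hpi]; nlinarith
  have hv2 : 2 / π * v ≤ 2 * n + 2 := by
    rw [div_mul_eq_mul_div, div_le_iff₀ hpi]
    push_cast at hn2
    nlinarith
  rw [abs_le]
  constructor <;> linarith

/-! ### `∫_a^b |cos v| dv/v ≤ (2/π) log(b/a) + 4/a` -/

/-- **The mean value of `|cos|` against `dv/v`**: for `0 < a ≤ b`,
`∫_a^b |cos v|/v dv ≤ (2/π) log(b/a) + 4/a` (integration by parts with the primitive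
`P(v) = ∫_0^v |cos|`, `|P(v) - (2/π)v| ≤ 2`). [cite: GranvilleSoundararajan2003, proof of Lemma 2.3] -/
theorem integral_abs_cos_div_le {a b : ℝ} (ha : 0 < a) (hab : a ≤ b) :
    ∫ v in a..b, |Real.cos v| / v ≤ 2 / π * Real.log (b / a) + 4 / a := by
  have hpi : 0 < π := Real.pi_pos
  have hb : 0 < b := ha.trans_le hab
  set P : ℝ → ℝ := fun v => ∫ x in (0 : ℝ)..v, |Real.cos x| with hP
  have hPderiv : ∀ v : ℝ, HasDerivAt P (|Real.cos v|) v := fun v =>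
    (continuous_abs_cos.integral_hasStrictDerivAt 0 v).hasDerivAt
  have hPcont : Continuous P := continuous_primitive (fun c d => intervalIntegrable_abs_cos c d) 0
  have hPbound : ∀ v : ℝ, 0 ≤ v → |P v - 2 / π * v| ≤ 2 := fun v hv => abs_integral_abs_cos_sub_le hv
  have hmem : ∀ v ∈ uIcc a b, 0 < v := by
    intro v hv
    rw [uIcc_of_le hab] at hv
    exact ha.trans_le hv.1
  -- integration by parts: `∫ v⁻¹ P' = [v⁻¹ P] - ∫ (-(v²)⁻¹) P`
  have hu : ∀ v ∈ uIcc a b, HasDerivAt (fun v : ℝ => v⁻¹) (-(v ^ 2)⁻¹) v := fun v hv =>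
    hasDerivAt_inv (hmem v hv).ne'
  have hv' : ∀ v ∈ uIcc a b, HasDerivAt P (|Real.cos v|) v := fun v _ => hPderiv v
  have hsqcont : ContinuousOn (fun v : ℝ => (v ^ 2)⁻¹) (uIcc a b) :=
    ContinuousOn.inv₀ (continuousOn_pow 2) fun v hv => pow_ne_zero _ (hmem v hv).ne'
  have hinvcont : ContinuousOn (fun v : ℝ => v⁻¹) (uIcc a b) :=
    ContinuousOn.inv₀ continuousOn_id fun v hv => (hmem v hv).ne'
  have hu'int : IntervalIntegrable (fun v : ℝ => -(v ^ 2)⁻¹) volume a b :=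
    hsqcont.neg.intervalIntegrable
  have hparts := integral_mul_deriv_eq_deriv_mul hu hv' hu'int (intervalIntegrable_abs_cos a b)
  have hlhs : ∫ v in a..b, |Real.cos v| / v = ∫ v in a..b, v⁻¹ * |Real.cos v| := by
    refine integral_congr fun v _ => ?_
    exact div_eq_inv_mul _ _
  rw [hlhs, hparts]
  -- the integral term `∫ (v²)⁻¹ P(v) ≤ (2/π) log(b/a) + 2/a - 2/b`
  have hI : -(∫ v in a..b, -(v ^ 2)⁻¹ * P v) ≤ 2 / π * Real.log (b / a) + (2 / a - 2 / b) := by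
    rw [← intervalIntegral.integral_neg]
    have h1 : ∫ v in a..b, -(-(v ^ 2)⁻¹ * P v) ≤ ∫ v in a..b, (2 / π * v⁻¹ + 2 * (v ^ 2)⁻¹) := by
      refine integral_mono_on hab ?_ ?_ fun v hv => ?_
      · exact ((hsqcont.neg.mul hPcont.continuousOn).neg).intervalIntegrable
      · exact ((continuousOn_const.mul hinvcont).add (continuousOn_const.mul hsqcont)).intervalIntegrable
      · have hv0 : 0 < v := ha.trans_le hv.1
        have hPv := hPbound v hv0.le
        rw [abs_le] at hPv
        have : P v ≤ 2 / π * v + 2 := by linarith [hPv.2]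
        calc -(-(v ^ 2)⁻¹ * P v) = (v ^ 2)⁻¹ * P v := by ring
          _ ≤ (v ^ 2)⁻¹ * (2 / π * v + 2) := mul_le_mul_of_nonneg_left this (by positivity)
          _ = 2 / π * v⁻¹ + 2 * (v ^ 2)⁻¹ := by field_simp
    have h2 : ∫ v in a..b, (2 / π * v⁻¹ + 2 * (v ^ 2)⁻¹) = 2 / π * Real.log (b / a) + (2 / a - 2 / b) := by
      have hi1 : IntervalIntegrable (fun v : ℝ => 2 / π * v⁻¹) volume a b :=
        (continuousOn_const.mul hinvcont).intervalIntegrable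
      have hi2 : IntervalIntegrable (fun v : ℝ => 2 * (v ^ 2)⁻¹) volume a b :=
        (continuousOn_const.mul hsqcont).intervalIntegrable
      rw [integral_add hi1 hi2, intervalIntegral.integral_const_mul, intervalIntegral.integral_const_mul,
        integral_inv (fun h0 => (lt_irrefl (0 : ℝ)) (hmem 0 h0))]
      have hsq : ∫ v in a..b, (v ^ 2)⁻¹ = a⁻¹ - b⁻¹ := by
        have h' : ∫ v in a..b, -(v ^ 2)⁻¹ = b⁻¹ - a⁻¹ := integral_eq_sub_of_hasDerivAt hu hu'int
        rw [intervalIntegral.integral_neg] at h'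
        linarith
      rw [hsq]
      ring
    linarith
  -- the boundary terms `P(b)/b - P(a)/a ≤ 2/b + 2/a`
  have hBb : b⁻¹ * P b ≤ 2 / π + 2 / b := by
    have hPv := hPbound b hb.le
    rw [abs_le] at hPv
    have : P b ≤ 2 / π * b + 2 := by linarith [hPv.2]
    calc b⁻¹ * P b ≤ b⁻¹ * (2 / π * b + 2) := mul_le_mul_of_nonneg_left this (by positivity)
      _ = 2 / π + 2 / b := by field_simp
  have hBa : -(a⁻¹ * P a) ≤ -(2 / π) + 2 / a := by
    have hPv := hPbound a ha.le
    rw [abs_le] at hPv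
    have : 2 / π * a - 2 ≤ P a := by linarith [hPv.1]
    have h := mul_le_mul_of_nonneg_left this (inv_nonneg.mpr ha.le)
    have e : a⁻¹ * (2 / π * a - 2) = 2 / π - 2 / a := by field_simp
    linarith
  have hab' : 2 / b ≤ 2 / a := div_le_div_of_nonneg_left (by norm_num) ha hab
  have hsum := add_le_add (add_le_add hBb hBa) hI
  calc b⁻¹ * P b - a⁻¹ * P a - ∫ x in a..b, -(x ^ 2)⁻¹ * P x
      = b⁻¹ * P b + -(a⁻¹ * P a) + -∫ x in a..b, -(x ^ 2)⁻¹ * P x := by ring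
    _ ≤ 2 / π + 2 / b + (-(2 / π) + 2 / a) + (2 / π * Real.log (b / a) + (2 / a - 2 / b)) := hsum
    _ = 2 / π * Real.log (b / a) + 4 / a := by ring

/-- **Rescaled form**: for `κ > 0`, `0 < Λ ≤ ℓ` with `κ Λ ≥ 1/2`,
`∫_Λ^ℓ |cos(κ u)|/u du ≤ (2/π) log(ℓ/Λ) + 8` (substitute `v = κ u`; GS03 use `κ = |β|/2`,
`Λ = log Y ≥ 1/|β|`, `ℓ = log x`). [cite: GranvilleSoundararajan2003, proof of Lemma 2.3] -/
theorem integral_abs_cos_mul_div_le {κ Λ ℓ : ℝ} (hκ : 0 < κ) (hΛ : 0 < Λ) (hΛℓ : Λ ≤ ℓ)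
    (hκΛ : 1 / 2 ≤ κ * Λ) :
    ∫ u in Λ..ℓ, |Real.cos (κ * u)| / u ≤ 2 / π * Real.log (ℓ / Λ) + 8 := by
  have hmem : ∀ u ∈ uIcc Λ ℓ, 0 < u := by
    intro u hu
    rw [uIcc_of_le hΛℓ] at hu
    exact hΛ.trans_le hu.1
  -- `|cos(κu)|/u = κ · F(κ u)` with `F(v) = |cos v|/v`
  have h1 : ∫ u in Λ..ℓ, |Real.cos (κ * u)| / u = ∫ u in Λ..ℓ, κ * (|Real.cos (κ * u)| / (κ * u)) := by
    refine integral_congr fun u hu => ?_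
    have hu0 : (u : ℝ) ≠ 0 := (hmem u hu).ne'
    field_simp
  have h3 : ∫ u in Λ..ℓ, |Real.cos (κ * u)| / (κ * u) = κ⁻¹ * ∫ v in κ * Λ..κ * ℓ, |Real.cos v| / v := by
    have := intervalIntegral.integral_comp_mul_left (fun v : ℝ => |Real.cos v| / v) hκ.ne' (a := Λ) (b := ℓ)
    simpa only [smul_eq_mul] using this
  rw [h1, intervalIntegral.integral_const_mul, h3, ← mul_assoc, mul_inv_cancel₀ hκ.ne', one_mul]
  have hκa : 0 < κ * Λ := by positivity
  have h2 := integral_abs_cos_div_le hκa (mul_le_mul_of_nonneg_left hΛℓ hκ.le)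
  have hlog : Real.log (κ * ℓ / (κ * Λ)) = Real.log (ℓ / Λ) := by
    rw [mul_div_mul_left _ _ hκ.ne']
  rw [hlog] at h2
  have h4 : 4 / (κ * Λ) ≤ 8 := by
    rw [div_le_iff₀ hκa]; linarith
  linarith

end Literature.NumberTheory.LFunctions.GranvilleSoundararajan
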